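import Summits.Langlands.Langlands.Theses.WeightMultiplicitySplit

/-!
# Glue of the layer-2 SPLIT of `DegenerateWeightReciprocity` (route WeightMultiplicitySplit) — target
`Summits/Langlands/Langlands/Theorems/WeightMultiplicitySplitDegenerateWeightReciprocityOfSplit.lean`

Closes the gate-generated glue item (children → parent, no outside hypothesis)
`DegenerateWeightReciprocity_of_split : DegenerateAutomorphicToGalois → DegenerateArtinTypeAutomorphy → DegenerateStructuredAutomorphy → DegenerateLieIrreducibleAutomorphy → MultiplicityTwoRankStep → DegenerateWeightReciprocity`
of `ledger route edit route-Langlands-WeightMultiplicitySplit --split DegenerateWeightReciprocity --into children_D.json --k-override 5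
--glue-decl-name DegenerateWeightReciprocity_of_split` (lens-2-g10 node `IrregularLieTypeSplit`, decomp-langlands, 2026-08-30).  The fifth child
`MultiplicityTwoRankStep` is the FEED piece (= the route's cruxes `GenericWeightReciprocity` 24355 ∧ `WallWeightReciprocity` 24354 in IH form; it closes
from them by the one-liner staged in `kit_check.lean`, and from the W-family).  To be proposed AFTER the split lands (`--supports <new glue item>`):
DELETE the block between the `-- MOCK BEGIN` / `-- MOCK END` markers and replace the prefix `WeightMultiplicitySplit.` by
`WeightMultiplicitySplit.` in the theorem statement.  Certified beforehand against the mock below AND against a verbatim copy of the route file of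
record (rev 0) extended exactly as the gate renders the two splits (`kit_check.lean`: rc 0 · 0 sorry · axioms propext / Classical.choice / Quot.sound).
PURE LOGIC: ONE strong induction on the rank `n` (the five children carry the inlined induction hypothesis «the tree's
`GlobalLanglandsCorrespondenceGLn` at every rank m < n over every number field and datum»), then excluded middle on the INLINED chamber condition
(multiplicity ≤ 2 → the feed `MultiplicityTwoRankStep`) and on the dials «ρ potentially scalar?», else «ρ Lie-irreducible?».  No new mathematics,
0 EQUIV, no definitions.
-/

set_option linter.dupNamespace false -- project-wide option; `Summit.Langlands.Langlands` is the mandated namespace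


namespace Summit.Langlands.Langlands.Theorems

open scoped Classical
open Summit.Langlands.Langlands.Theses

/-- The glue item of the lens-2-g10 split of `WeightMultiplicitySplit.DegenerateWeightReciprocity` (stmt-Langlands-24356): the five children
`DegenerateAutomorphicToGalois` ((A)-clause + non-vacuity), `DegenerateArtinTypeAutomorphy` ((B), ρ potentially scalar), `DegenerateStructuredAutomorphy`
((B), ρ neither potentially scalar nor Lie-irreducible), `DegenerateLieIrreducibleAutomorphy` ((B), ρ Lie-irreducible, not potentially scalar) and the
feed `MultiplicityTwoRankStep` (multiplicity-≤-2 reciprocity at the rank) — each stated GIVEN reciprocity below the rank — imply the parent, by strong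
induction on the rank and cases on the inlined dials. -/
theorem WeightMultiplicitySplit_DegenerateWeightReciprocity_of_split_proof :
    Summit.Langlands.Langlands.Theses.WeightMultiplicitySplit.DegenerateWeightReciprocity_of_split := by
  intro hA hF hS hP hMb
  have key : ∀ (n : ℕ) (F : Type) [Field F] [NumberField F] (Rd : Summit.Langlands.ReciprocityData F), 0 < n →
      ∀ hcpt : Literature.NumberTheory.Automorphic.isCompact_glFiniteIntegralLevel n F, Summit.Langlands.GlobalLanglandsCorrespondenceGLn n F Rd hcpt := by
    intro n
    induction n using Nat.strong_induction_on with
    | _ n ih =>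
      intro F _ _ Rd hn hcpt
      have hIH : (∀ (m : ℕ), m < n → 0 < m → ∀ (L : Type) [Field L] [NumberField L] (RdL : Summit.Langlands.ReciprocityData L) (hcptL : Literature.NumberTheory.Automorphic.isCompact_glFiniteIntegralLevel m L), Summit.Langlands.GlobalLanglandsCorrespondenceGLn m L RdL hcptL) := fun m hm hm0 L _ _ RdL hcptL => ih m hm L RdL hm0 hcptL
      unfold Summit.Langlands.GlobalLanglandsCorrespondenceGLn Summit.Langlands.AutomorphicToGalois Summit.Langlands.GaloisToAutomorphic
      refine ⟨?_, ?_⟩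
      · intro π hπ ℓ _ ι
        by_cases h2 : (∃ T : Literature.NumberTheory.Automorphic.InfinityType F n, π.1.HasInfinityType T ∧ ∀ (σ : F →+* ℂ) (a : ℂ), ((T σ).map Literature.NumberTheory.Automorphic.ArchWeight.a).count a ≤ 2)
        · exact (hMb F Rd n hn hcpt hIH).1 π hπ h2 ℓ ι
        · exact (hA F).2 Rd n hn hcpt hIH π hπ h2 ℓ ι
      · intro ℓ _ ι ρ hirr hgeo
        by_cases h2 : (∀ (v : IsDedekindDomain.HeightOneSpectrum (NumberField.RingOfIntegers F)) (hv : ((ℓ : ℕ) : NumberField.RingOfIntegers F) ∈ v.asIdeal) (τ : v.adicCompletion F →+* PadicAlgCl ℓ), Continuous τ → ∀ w : ℤ, (ρ.labelledHodgeTateWeightsAt v (Literature.NumberTheory.PAdicHodge.fontainePstAdicCompletion v ℓ hv).algebra (Literature.NumberTheory.PAdicHodge.fontainePstAdicCompletion v ℓ hv).𝔅 τ).count w ≤ 2)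
        · exact (hMb F Rd n hn hcpt hIH).2 ℓ ι ρ hirr hgeo h2
        · by_cases hf : (∃ (L : Type) (_ : Field L) (_ : NumberField L) (_ : Algebra F L), ∀ σ : Field.absoluteGaloisGroup L, ∃ c : PadicAlgCl ℓ, ((ρ.restrictField L σ : GL (Fin n) (PadicAlgCl ℓ)) : Matrix (Fin n) (Fin n) (PadicAlgCl ℓ)) = c • (1 : Matrix (Fin n) (Fin n) (PadicAlgCl ℓ)))
          · exact hF F Rd n hn hcpt hIH ℓ ι ρ hirr hgeo ⟨h2, hf⟩
          · by_cases hl : (∀ (L : Type) [Field L] [NumberField L] [Algebra F L], (ρ.restrictField L).toGaloisRep.IsIrreducible)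
            · exact hP F Rd n hn hcpt hIH ℓ ι ρ hirr hgeo ⟨h2, hf, hl⟩
            · exact hS F Rd n hn hcpt hIH ℓ ι ρ hirr hgeo ⟨h2, hf, hl⟩
  intro F _ _
  refine ⟨(hA F).1, fun Rd n hn hcpt => ⟨?_, ?_⟩⟩
  · intro π hπ _ ℓ _ ι
    exact (key n F Rd hn hcpt).1 π hπ ℓ ι
  · intro ℓ _ ι ρ hirr hgeo _
    exact (key n F Rd hn hcpt).2 ℓ ι ρ hirr hgeo
end Summit.Langlands.Langlands.Theorems
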